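import Mathlib
import Summits.HodgeConjecture.HodgeConjecture.Theorems.HodgeLocusCensusUnitColumnRankD4
import Summits.HodgeConjecture.HodgeConjecture.Theorems.HodgeLocusCensusUnitColumnRankLevels
import Summits.HodgeConjecture.HodgeConjecture.Theorems.HodgeLocusCensusUnitColumnRankLevelsPowers

/-!
# THE MODEL'S MATRIX IDENTITY inside Lean — ENGINE B (gen 52 PROBES 7–8; successor sheet β)

certified instances and evidence bearing on the general Hodge conjecture; no claim.

Every anchor of the unit-column class (174 / 191 / 199 / 204 / 219 / 220 / 222 / 229) computes the rank of a 0/1 or multiplicity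
matrix built from gen 31's column expansion `colR`, and leaves OUTSIDE Lean the statement that this matrix is the matrix of
`×q^c : B_{k(e+1)−j−c(e+1)} → B_{k(e+1)−j}` on the MODEL `B = K[x₁,…,x_k]/(xᵢ^{e+2})`, `q = Σ xᵢ^{e+1}` (THEOREM K-MODEL), in the
monomial bases.  This file proves that statement for the MODEL, with `B` realised as Mathlib's
`MvPolynomial (Fin k) K ⧸ Ideal.span {Xᵢ^(e+2)}` and exponent functions `m : Fin k → Fin (e+2)` sent to exponent vectors by
`Finsupp.equivFunOnFinite.symm`:
* `coeff_qpow_mul_monomial` (any commutative semiring `K`): the coefficient of `X^v` in `q^c · X^m` (in the polynomial ring) is the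
  multiplicity of `List.ofFn v` in `(List.flatMap (colR (e+3)))^[c] [List.ofFn m]` — induction on `c`: `q^{c+1}X^m = Σᵢ q^c·(Xᵢ^{e+1}X^m)`,
  a zero coordinate `i` of `m` is raised (`single_add_eq_update`, then the induction hypothesis), a non-zero one overflows past every
  bounded `v` (`MvPolynomial.coeff_mul_monomial'`); the list side is anchor 229's `iterate_flatMap_eq` / `colR_toFinset` BY NAME;
* `jacobianIdeal_fermat` (field of characteristic `0`): that ideal IS the Jacobian ideal `(∂₁F,…,∂_kF)` of the Fermat polynomial
  `F = Σⱼ Xⱼ^(e+3)` of degree `d = e + 3` (`MvPolynomial.pderiv`; `pderiv_fermat`: `∂ᵢF = (e+3)·Xᵢ^(e+2)`), so `B` is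
  Mathlib-literally `K[X]/J(F)`;
* `mk_eq_mk_iff` (commutative ring `K`): two polynomials have the same class in `B` iff their BOUNDED coefficients agree (Mathlib's
  monomial-ideal membership `MvPolynomial.mem_ideal_span_monomial_image`); `mk_eq_mk_sum_bounded`: every class is the class of its
  bounded part — so the bounded monomials index a basis of `B`;
* `mk_qpow_mul_monomial` / `mk_q_pow_mul_mk_monomial`: in `B`, `q̄^c · [X^m] = Σ_v M_{v,m} • [X^v]` with `M_{v,m}` that multiplicity — THE MATRIX
  OF `×q^c` ON `B` IN THE BOUNDED-MONOMIAL BASES IS THE CENSUS MATRIX;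
* `coeff_q_mul_monomial` (`c = 1`: the coefficient is anchor 174's indicator `[ofFn v ∈ colR (e+3) (ofFn m)]`, `indicator_eq_count_colR`
  BY NAME), and THEOREM L restated with coefficient entries: `rank_coeff_q_levels` (= anchor 222's `rank_mulDelta_levels` BY NAME) and
  `rank_coeff_qpow_levels` (= anchor 229's `rank_mulDeltaPow_levels` BY NAME, every `d`, `c`, level).
Imports `Mathlib` + anchors 174 / 222 / 229 BY NAME; nothing restated; theorem-only, definition-free, no `decide`.
Evidence-class material; no census number changes; nothing about HC.
-/

set_option linter.dupNamespace false
set_option autoImplicit false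

namespace Summit.HodgeConjecture.HodgeConjecture.HodgeLocus.Census.UnitColumnModelMatrix

open Summit.HodgeConjecture.HodgeConjecture.HodgeLocus.Census.ModelNonJumpC1All (colR)
open Summit.HodgeConjecture.HodgeConjecture.HodgeLocus.Census.UnitColumnRankD4 (colR_nodup indicator_eq_count_colR)
open Summit.HodgeConjecture.HodgeConjecture.HodgeLocus.Census.UnitColumnRankLevels (rank_mulDelta_levels)
open Summit.HodgeConjecture.HodgeConjecture.HodgeLocus.Census.UnitColumnRankLevelsPowers
  (iterate_flatMap_eq colR_toFinset rank_mulDeltaPow_levels)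
open Matrix Module

/-- raising a zero coordinate, in exponent-vector form: `(e+1)·δᵢ + m = update m i (e+1)` -/
theorem single_add_eq_update {k e : ℕ} (m : Fin k → Fin (e + 2)) (i : Fin k) (hi : (m i : ℕ) = 0) :
    Finsupp.single i (e + 1) + Finsupp.equivFunOnFinite.symm (fun l => (m l : ℕ)) =
      Finsupp.equivFunOnFinite.symm (fun l => ((Function.update m i (Fin.last (e + 1)) l : Fin (e + 2)) : ℕ)) := by
  ext l
  simp only [Finsupp.add_apply, Finsupp.single_apply, Finsupp.coe_equivFunOnFinite_symm, Function.update_apply]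
  by_cases h : l = i
  · subst h
    rw [if_pos rfl, if_pos rfl, hi, Fin.val_last]
  · rw [if_neg (fun h' => h h'.symm), if_neg h, zero_add]

/-- **PROBE 7**: the coefficient of `X^v` in `q^c · X^m` (`q = Σᵢ Xᵢ^(e+1)`, bounded `m v`) is the `colR`-iterate multiplicity. -/
theorem coeff_qpow_mul_monomial (K : Type*) [CommSemiring K] {k e : ℕ} (c : ℕ) : ∀ (m v : Fin k → Fin (e + 2)),
    MvPolynomial.coeff (Finsupp.equivFunOnFinite.symm (fun l => (v l : ℕ)))
        ((∑ i : Fin k, (MvPolynomial.X i : MvPolynomial (Fin k) K) ^ (e + 1)) ^ c *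
          MvPolynomial.monomial (Finsupp.equivFunOnFinite.symm (fun l => (m l : ℕ))) 1) =
      ((((List.flatMap (colR (e + 3)))^[c] [List.ofFn (fun l => (m l : ℕ))]).count (List.ofFn (fun l => (v l : ℕ))) : ℕ) : K) := by
  classical
  induction c with
  | zero =>
    intro m v
    rw [pow_zero, one_mul, MvPolynomial.coeff_monomial, Function.iterate_zero_apply]
    by_cases h : m = v
    · subst h
      rw [if_pos rfl, List.count_singleton_self, Nat.cast_one]
    · have h1 : Finsupp.equivFunOnFinite.symm (fun l => (m l : ℕ)) ≠ Finsupp.equivFunOnFinite.symm (fun l => (v l : ℕ)) := by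
        intro heq
        apply h
        have h2 := Finsupp.equivFunOnFinite.symm.injective heq
        funext l
        exact Fin.ext (congrFun h2 l)
      have h3 : List.ofFn (fun l => (v l : ℕ)) ∉ [List.ofFn (fun l => (m l : ℕ))] := by
        intro hmem
        apply h
        have h4 := List.ofFn_inj.mp (List.mem_singleton.mp hmem)
        funext l
        exact Fin.ext (congrFun h4 l).symm
      rw [if_neg h1, List.count_eq_zero.mpr h3, Nat.cast_zero]
  | succ c ih =>
    intro m v
    rw [pow_succ, mul_assoc, Finset.sum_mul, Finset.mul_sum, MvPolynomial.coeff_sum]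
    simp_rw [← MvPolynomial.monomial_single_add]
    rw [Function.iterate_succ_apply, List.flatMap_singleton, iterate_flatMap_eq, List.count_flatMap,
      ← List.sum_toFinset _ (colR_nodup (e + 3) (by omega) _), colR_toFinset, Finset.sum_image]
    · simp only [Function.comp_apply]
      rw [Nat.cast_sum, ← Finset.sum_filter_add_sum_filter_not Finset.univ (fun i => (m i : ℕ) = 0)]
      have hvan : ∑ i ∈ Finset.univ.filter (fun i => ¬ (m i : ℕ) = 0),
          MvPolynomial.coeff (Finsupp.equivFunOnFinite.symm (fun l => (v l : ℕ)))
            ((∑ i : Fin k, (MvPolynomial.X i : MvPolynomial (Fin k) K) ^ (e + 1)) ^ c *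
              MvPolynomial.monomial (Finsupp.single i (e + 1) + Finsupp.equivFunOnFinite.symm (fun l => (m l : ℕ))) 1) = 0 := by
        refine Finset.sum_eq_zero (fun i hi => ?_)
        simp only [Finset.mem_filter, Finset.mem_univ, true_and] at hi
        rw [MvPolynomial.coeff_mul_monomial', if_neg]
        intro hle
        have h1 := Finsupp.le_def.mp hle i
        simp only [Finsupp.add_apply, Finsupp.single_eq_same, Finsupp.coe_equivFunOnFinite_symm] at h1
        have h2 := (v i).isLt
        omega
      rw [hvan, add_zero]
      refine Finset.sum_congr rfl (fun i hi => ?_)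
      simp only [Finset.mem_filter, Finset.mem_univ, true_and] at hi
      rw [single_add_eq_update m i hi]
      exact ih _ _
    · intro i hi i' hi' h
      rw [Finset.coe_filter] at hi
      have h0 : (m i : ℕ) = 0 := hi.2
      have hf := congrFun (List.ofFn_inj.mp h) i
      by_contra hne
      rw [Function.update_apply, Function.update_apply, if_pos rfl, if_neg hne, Fin.val_last, h0] at hf
      exact Nat.succ_ne_zero e hf


/-- bounded exponent functions give the same exponent vector only if they are equal -/
theorem toF_inj {k e : ℕ} (v w : Fin k → Fin (e + 2)) :
    Finsupp.equivFunOnFinite.symm (fun l => (v l : ℕ)) = Finsupp.equivFunOnFinite.symm (fun l => (w l : ℕ)) ↔ v = w := by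
  constructor
  · intro heq
    have h2 := Finsupp.equivFunOnFinite.symm.injective heq
    funext l
    exact Fin.ext (congrFun h2 l)
  · rintro rfl
    rfl

/-- the truncation ideal `(X_1^(e+2), …, X_k^(e+2))` is the monomial ideal of the exponent vectors `(e+2)·δᵢ` -/
theorem range_X_pow_eq (K : Type*) [CommSemiring K] (k e : ℕ) :
    Set.range (fun i : Fin k => (MvPolynomial.X i : MvPolynomial (Fin k) K) ^ (e + 2)) =
      (fun s => MvPolynomial.monomial s (1 : K)) '' Set.range (fun i : Fin k => Finsupp.single i (e + 2)) := by
  rw [← Set.range_comp]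
  congr 1
  funext i
  exact MvPolynomial.X_pow_eq_monomial

/-- the partial derivatives of the Fermat polynomial: `∂ᵢ (Σⱼ Xⱼ^(e+3)) = (e+3)·Xᵢ^(e+2)` -/
theorem pderiv_fermat (K : Type*) [CommSemiring K] {k : ℕ} (e : ℕ) (i : Fin k) :
    MvPolynomial.pderiv i (∑ j : Fin k, (MvPolynomial.X j : MvPolynomial (Fin k) K) ^ (e + 3)) =
      MvPolynomial.C ((e + 3 : ℕ) : K) * (MvPolynomial.X i : MvPolynomial (Fin k) K) ^ (e + 2) := by
  classical
  rw [map_sum, Finset.sum_eq_single i]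
  · rw [MvPolynomial.pderiv_pow, MvPolynomial.pderiv_X_self, mul_one, show e + 3 - 1 = e + 2 from rfl, map_natCast]
  · intro j _ hj
    rw [MvPolynomial.pderiv_pow, MvPolynomial.pderiv_X_of_ne hj, mul_zero]
  · intro h
    exact absurd (Finset.mem_univ i) h

/-- **JACOBIAN IDEAL OF THE FERMAT POLYNOMIAL** (characteristic `0`): `(∂₁F, …, ∂_kF) = (X₁^(e+2), …, X_k^(e+2))` for `F = Σⱼ Xⱼ^(e+3)`. -/
theorem jacobianIdeal_fermat (K : Type*) [Field K] [CharZero K] {k : ℕ} (e : ℕ) :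
    Ideal.span (Set.range (fun i : Fin k =>
        MvPolynomial.pderiv i (∑ j : Fin k, (MvPolynomial.X j : MvPolynomial (Fin k) K) ^ (e + 3)))) =
      Ideal.span (Set.range (fun i : Fin k => (MvPolynomial.X i : MvPolynomial (Fin k) K) ^ (e + 2))) := by
  have hne : ((e + 3 : ℕ) : K) ≠ 0 := by exact_mod_cast Nat.succ_ne_zero (e + 2)
  apply le_antisymm
  · rw [Ideal.span_le]
    rintro x ⟨i, rfl⟩
    dsimp only
    rw [pderiv_fermat K e i]
    exact Ideal.mul_mem_left _ _ (Ideal.subset_span ⟨i, rfl⟩)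
  · rw [Ideal.span_le]
    rintro x ⟨i, rfl⟩
    have hx : (MvPolynomial.X i : MvPolynomial (Fin k) K) ^ (e + 2) =
        MvPolynomial.C (((e + 3 : ℕ) : K)⁻¹) *
          MvPolynomial.pderiv i (∑ j : Fin k, (MvPolynomial.X j : MvPolynomial (Fin k) K) ^ (e + 3)) := by
      rw [pderiv_fermat, ← mul_assoc, ← MvPolynomial.C_mul, inv_mul_cancel₀ hne, MvPolynomial.C_1, one_mul]
    dsimp only
    rw [hx]
    exact Ideal.mul_mem_left _ _ (Ideal.subset_span ⟨i, rfl⟩)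

/-- **THE MODEL, (i) bounded monomials separate**: two polynomials have the same class in `B = K[X]/(Xᵢ^(e+2))` iff their
coefficients at all BOUNDED exponent vectors agree (Mathlib's monomial-ideal membership `mem_ideal_span_monomial_image`). -/
theorem mk_eq_mk_iff (K : Type*) [CommRing K] {k e : ℕ} (p p' : MvPolynomial (Fin k) K) :
    Ideal.Quotient.mk (Ideal.span (Set.range (fun i : Fin k => (MvPolynomial.X i : MvPolynomial (Fin k) K) ^ (e + 2)))) p =
        Ideal.Quotient.mk (Ideal.span (Set.range (fun i : Fin k => (MvPolynomial.X i : MvPolynomial (Fin k) K) ^ (e + 2)))) p' ↔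
      ∀ v : Fin k → Fin (e + 2), MvPolynomial.coeff (Finsupp.equivFunOnFinite.symm (fun l => (v l : ℕ))) p =
        MvPolynomial.coeff (Finsupp.equivFunOnFinite.symm (fun l => (v l : ℕ))) p' := by
  rw [Ideal.Quotient.eq, range_X_pow_eq, MvPolynomial.mem_ideal_span_monomial_image]
  constructor
  · intro h v
    by_contra hne
    have hmem : Finsupp.equivFunOnFinite.symm (fun l => (v l : ℕ)) ∈ (p - p').support := by
      rw [MvPolynomial.mem_support_iff, MvPolynomial.coeff_sub]
      exact sub_ne_zero.mpr hne
    obtain ⟨si, ⟨i, rfl⟩, hle⟩ := h _ hmem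
    have h1 := Finsupp.single_le_iff.mp hle
    simp only [Finsupp.coe_equivFunOnFinite_symm] at h1
    have h2 := (v i).isLt
    omega
  · intro h xi hxi
    by_contra hno
    push Not at hno
    have hb : ∀ i, xi i < e + 2 := by
      intro i
      by_contra hge
      push Not at hge
      exact hno _ ⟨i, rfl⟩ (Finsupp.single_le_iff.mpr hge)
    have hxv : xi = Finsupp.equivFunOnFinite.symm (fun l => ((⟨xi l, hb l⟩ : Fin (e + 2)) : ℕ)) := by
      ext l
      simp only [Finsupp.coe_equivFunOnFinite_symm]
    rw [MvPolynomial.mem_support_iff, hxv, MvPolynomial.coeff_sub, h _, sub_self] at hxi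
    exact hxi rfl

/-- **THE MODEL, (ii) bounded monomials span**: every class in `B` is the class of its bounded part. -/
theorem mk_eq_mk_sum_bounded (K : Type*) [CommRing K] {k e : ℕ} (p : MvPolynomial (Fin k) K) :
    Ideal.Quotient.mk (Ideal.span (Set.range (fun i : Fin k => (MvPolynomial.X i : MvPolynomial (Fin k) K) ^ (e + 2)))) p =
      Ideal.Quotient.mk (Ideal.span (Set.range (fun i : Fin k => (MvPolynomial.X i : MvPolynomial (Fin k) K) ^ (e + 2))))
        (∑ v : Fin k → Fin (e + 2), MvPolynomial.coeff (Finsupp.equivFunOnFinite.symm (fun l => (v l : ℕ))) p •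
          MvPolynomial.monomial (Finsupp.equivFunOnFinite.symm (fun l => (v l : ℕ))) (1 : K)) := by
  classical
  rw [mk_eq_mk_iff]
  intro w
  rw [MvPolynomial.coeff_sum]
  simp only [MvPolynomial.coeff_smul, MvPolynomial.coeff_monomial, smul_eq_mul, mul_ite, mul_one, mul_zero, toF_inj]
  rw [Finset.sum_ite_eq' Finset.univ w, if_pos (Finset.mem_univ w)]

/-- **THE MODEL, (iii) the matrix of `×q^c`**: in `B = K[X]/(Xᵢ^(e+2))`, `q^c · X^m = Σ_v M_{v,m} · X^v` over bounded `v`, with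
`M_{v,m}` = the `colR`-iterate multiplicity = the entry of the census matrices (anchors 174/…/222/229). -/
theorem mk_qpow_mul_monomial (K : Type*) [CommRing K] {k e : ℕ} (c : ℕ) (m : Fin k → Fin (e + 2)) :
    Ideal.Quotient.mk (Ideal.span (Set.range (fun i : Fin k => (MvPolynomial.X i : MvPolynomial (Fin k) K) ^ (e + 2))))
        ((∑ i : Fin k, (MvPolynomial.X i : MvPolynomial (Fin k) K) ^ (e + 1)) ^ c *
          MvPolynomial.monomial (Finsupp.equivFunOnFinite.symm (fun l => (m l : ℕ))) 1) =
      Ideal.Quotient.mk (Ideal.span (Set.range (fun i : Fin k => (MvPolynomial.X i : MvPolynomial (Fin k) K) ^ (e + 2))))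
        (∑ v : Fin k → Fin (e + 2),
          ((((List.flatMap (colR (e + 3)))^[c] [List.ofFn (fun l => (m l : ℕ))]).count (List.ofFn (fun l => (v l : ℕ))) : ℕ) : K) •
            MvPolynomial.monomial (Finsupp.equivFunOnFinite.symm (fun l => (v l : ℕ))) (1 : K)) := by
  rw [mk_eq_mk_sum_bounded K ((∑ i : Fin k, (MvPolynomial.X i : MvPolynomial (Fin k) K) ^ (e + 1)) ^ c * _)]
  congr 1
  refine Finset.sum_congr rfl (fun v _ => ?_)
  rw [coeff_qpow_mul_monomial K c m v]


/-- **THE MODEL, (iii′) in `B` itself**: `q̄^c · [X^m] = Σ_v M_{v,m} • [X^v]` in the `K`-algebra `B = K[X]/(Xᵢ^(e+2))`. -/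
theorem mk_q_pow_mul_mk_monomial (K : Type*) [CommRing K] {k e : ℕ} (c : ℕ) (m : Fin k → Fin (e + 2)) :
    (Ideal.Quotient.mk (Ideal.span (Set.range (fun i : Fin k => (MvPolynomial.X i : MvPolynomial (Fin k) K) ^ (e + 2))))
        (∑ i : Fin k, (MvPolynomial.X i : MvPolynomial (Fin k) K) ^ (e + 1))) ^ c *
      Ideal.Quotient.mk (Ideal.span (Set.range (fun i : Fin k => (MvPolynomial.X i : MvPolynomial (Fin k) K) ^ (e + 2))))
        (MvPolynomial.monomial (Finsupp.equivFunOnFinite.symm (fun l => (m l : ℕ))) 1) =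
      ∑ v : Fin k → Fin (e + 2),
        ((((List.flatMap (colR (e + 3)))^[c] [List.ofFn (fun l => (m l : ℕ))]).count (List.ofFn (fun l => (v l : ℕ))) : ℕ) : K) •
          Ideal.Quotient.mk (Ideal.span (Set.range (fun i : Fin k => (MvPolynomial.X i : MvPolynomial (Fin k) K) ^ (e + 2))))
            (MvPolynomial.monomial (Finsupp.equivFunOnFinite.symm (fun l => (v l : ℕ))) (1 : K)) := by
  rw [← map_pow, ← map_mul, mk_qpow_mul_monomial, map_sum]
  refine Finset.sum_congr rfl (fun v _ => ?_)
  rw [← Ideal.Quotient.mkₐ_eq_mk K, map_smul]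

/-- `c = 1`: the coefficient of `X^v` in `q · X^m` is anchor 174's indicator entry `[ofFn v ∈ colR (e+3) (ofFn m)]` -/
theorem coeff_q_mul_monomial (K : Type*) [Field K] {k e : ℕ} (m v : Fin k → Fin (e + 2)) :
    MvPolynomial.coeff (Finsupp.equivFunOnFinite.symm (fun l => (v l : ℕ)))
        ((∑ i : Fin k, (MvPolynomial.X i : MvPolynomial (Fin k) K) ^ (e + 1)) *
          MvPolynomial.monomial (Finsupp.equivFunOnFinite.symm (fun l => (m l : ℕ))) 1) =
      if List.ofFn (fun l => (v l : ℕ)) ∈ colR (e + 3) (List.ofFn (fun l => (m l : ℕ))) then (1 : K) else 0 := by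
  have h := coeff_qpow_mul_monomial K 1 m v
  rw [pow_one, Function.iterate_one, List.flatMap_singleton] at h
  rw [h, indicator_eq_count_colR K (e + 3) (by omega)]

/-- **THEOREM L at `c = 1`, every `d = e + 3 ≥ 3`, every level, with `MvPolynomial` COEFFICIENT entries** (anchor 222's
`rank_mulDelta_levels` BY NAME, its indicator entries rewritten by `coeff_q_mul_monomial`): the matrix
`(coeff_{X^v} (q · X^m))_{v,m}` of `×q : B_{k(e+1)−j−(e+1)} → B_{k(e+1)−j}` in the bounded-monomial bases has the λ-form rank. -/
theorem rank_coeff_q_levels (K : Type*) [Field K] [CharZero K] (k e j : ℕ) :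
    (Matrix.of fun (v : {v : Fin k → Fin (e + 2) // (∑ i, (v i : ℕ)) + j = k * (e + 1)})
        (m : {m : Fin k → Fin (e + 2) // (∑ i, (m i : ℕ)) + (j + (e + 1)) = k * (e + 1)}) =>
      MvPolynomial.coeff (Finsupp.equivFunOnFinite.symm (fun i => (v.1 i : ℕ)))
        ((∑ i : Fin k, (MvPolynomial.X i : MvPolynomial (Fin k) K) ^ (e + 1)) *
          MvPolynomial.monomial (Finsupp.equivFunOnFinite.symm (fun i => (m.1 i : ℕ))) 1)).rank =
      ∑ μ : Fin k → Fin (e + 1),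
        (if (e + 1) ∣ (j + ∑ i, (μ i : ℕ)) ∧ (e + 1) * (Finset.univ.filter (fun l => (μ l : ℕ) ≠ 0)).card ≤ j + ∑ i, (μ i : ℕ) then
            min ((k - (Finset.univ.filter (fun l => (μ l : ℕ) ≠ 0)).card).choose
                  ((j + ∑ i, (μ i : ℕ)) / (e + 1) - (Finset.univ.filter (fun l => (μ l : ℕ) ≠ 0)).card))
              ((k - (Finset.univ.filter (fun l => (μ l : ℕ) ≠ 0)).card).choose
                  ((j + ∑ i, (μ i : ℕ)) / (e + 1) - (Finset.univ.filter (fun l => (μ l : ℕ) ≠ 0)).card + 1))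
          else 0) := by
  have hM : (Matrix.of fun (v : {v : Fin k → Fin (e + 2) // (∑ i, (v i : ℕ)) + j = k * (e + 1)})
        (m : {m : Fin k → Fin (e + 2) // (∑ i, (m i : ℕ)) + (j + (e + 1)) = k * (e + 1)}) =>
      MvPolynomial.coeff (Finsupp.equivFunOnFinite.symm (fun i => (v.1 i : ℕ)))
        ((∑ i : Fin k, (MvPolynomial.X i : MvPolynomial (Fin k) K) ^ (e + 1)) *
          MvPolynomial.monomial (Finsupp.equivFunOnFinite.symm (fun i => (m.1 i : ℕ))) 1)) =
      Matrix.of fun (v : {v : Fin k → Fin (e + 2) // (∑ i, (v i : ℕ)) + j = k * (e + 1)})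
        (m : {m : Fin k → Fin (e + 2) // (∑ i, (m i : ℕ)) + (j + (e + 1)) = k * (e + 1)}) =>
      if List.ofFn (fun i => (v.1 i : ℕ)) ∈ colR (e + 3) (List.ofFn (fun i => (m.1 i : ℕ))) then (1 : K) else 0 := by
    congr 1
    funext v m
    exact coeff_q_mul_monomial K m.1 v.1
  rw [hM]
  exact rank_mulDelta_levels K k e j

/-- **THEOREM L for every `d`, every power `c`, every level, with `MvPolynomial` COEFFICIENT entries** (anchor 229's `rank_mulDeltaPow_levels`
BY NAME, with its multiplicity entries rewritten by `coeff_qpow_mul_monomial`). -/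
theorem rank_coeff_qpow_levels (K : Type*) [Field K] [CharZero K] (k e c j : ℕ) :
    (Matrix.of fun (v : {v : Fin k → Fin (e + 2) // (∑ i, (v i : ℕ)) + j = k * (e + 1)})
        (m : {m : Fin k → Fin (e + 2) // (∑ i, (m i : ℕ)) + (j + c * (e + 1)) = k * (e + 1)}) =>
      MvPolynomial.coeff (Finsupp.equivFunOnFinite.symm (fun i => (v.1 i : ℕ)))
        ((∑ i : Fin k, (MvPolynomial.X i : MvPolynomial (Fin k) K) ^ (e + 1)) ^ c *
          MvPolynomial.monomial (Finsupp.equivFunOnFinite.symm (fun i => (m.1 i : ℕ))) 1)).rank =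
      ∑ μ : Fin k → Fin (e + 1),
        (if (e + 1) ∣ (j + ∑ i, (μ i : ℕ)) ∧ (e + 1) * (Finset.univ.filter (fun l => (μ l : ℕ) ≠ 0)).card ≤ j + ∑ i, (μ i : ℕ) then
            min ((k - (Finset.univ.filter (fun l => (μ l : ℕ) ≠ 0)).card).choose
                  ((j + ∑ i, (μ i : ℕ)) / (e + 1) - (Finset.univ.filter (fun l => (μ l : ℕ) ≠ 0)).card))
              ((k - (Finset.univ.filter (fun l => (μ l : ℕ) ≠ 0)).card).choose
                  ((j + ∑ i, (μ i : ℕ)) / (e + 1) - (Finset.univ.filter (fun l => (μ l : ℕ) ≠ 0)).card + c))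
          else 0) := by
  have hM : (Matrix.of fun (v : {v : Fin k → Fin (e + 2) // (∑ i, (v i : ℕ)) + j = k * (e + 1)})
        (m : {m : Fin k → Fin (e + 2) // (∑ i, (m i : ℕ)) + (j + c * (e + 1)) = k * (e + 1)}) =>
      MvPolynomial.coeff (Finsupp.equivFunOnFinite.symm (fun i => (v.1 i : ℕ)))
        ((∑ i : Fin k, (MvPolynomial.X i : MvPolynomial (Fin k) K) ^ (e + 1)) ^ c *
          MvPolynomial.monomial (Finsupp.equivFunOnFinite.symm (fun i => (m.1 i : ℕ))) 1)) =
      Matrix.of fun (v : {v : Fin k → Fin (e + 2) // (∑ i, (v i : ℕ)) + j = k * (e + 1)})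
        (m : {m : Fin k → Fin (e + 2) // (∑ i, (m i : ℕ)) + (j + c * (e + 1)) = k * (e + 1)}) =>
      ((((List.flatMap (colR (e + 3)))^[c] [List.ofFn (fun i => (m.1 i : ℕ))]).count (List.ofFn (fun i => (v.1 i : ℕ))) : ℕ) : K) := by
    congr 1
    funext v m
    exact coeff_qpow_mul_monomial K c m.1 v.1
  rw [hM]
  exact rank_mulDeltaPow_levels K k e c j

end Summit.HodgeConjecture.HodgeConjecture.HodgeLocus.Census.UnitColumnModelMatrix
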